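import Mathlib
import HarnessLib
import Summits.Ventures.LatticeQCDFlow.Exactness.NCMCGeneralSpaceKishOverestimate
import Summits.Ventures.LatticeQCDFlow.Exactness.NCMCGeneralSpaceKishSampleSizeRestartChain

/-!
# NCMCGeneralSpaceKishOverestimateRestartChain — the printed Kish ESS is over-optimistic with too
# few CONSECUTIVE EVOLUTIONS of the restart chain: under a work floor `W ≥ −B₀` and a level sampler
# with `K(z,·) ≥ ε·π₀`, `N ≤ e^{L₂ − t}` ⇒
# `P(ESŜ/N ≤ ((1−η)²/(1−δ))·ESS_F) ≤ e^{−t/2} + P₂-tail/(1−δ) + (2/ε − 1)(1/ESS_F − 1)/(Nη²)`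

HONEST FRAMING: exact (Metropolis-corrected) sampling algorithms for lattice gauge theory;
figures of merit are autocorrelation/cost numbers at stated couplings and volumes; no
continuum-physics claim.

Venture `LatticeQCDFlow` (cell pub-lqcd); FANOUT row 19 (`su2-snf`, GEN-8).  OUR WORK (a union
bound); nothing is cited as a fact.  `Exactness/NCMCGeneralSpaceKishOverestimate` proves the
statement for INDEPENDENT records; here the records are `N` consecutive evolutions of the engine's
equilibrium restart chain (row 13's `Exactness/NCMCGeneralSpaceMarkovRun`).  The two inputs become:
(1) the Kish-denominator NECESSITY along the chain, which needs NO mixing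
(`Exactness/NCMCGeneralSpaceKishSampleSizeRestartChain.kish_sampleSize_necessary_restartChain`);
(2) Chebyshev for the mean weight along the chain, whose variance is inflated by at most
`C = 2/ε − 1` under the minorisation `ε·π₀ ≤ K(z, ·)`
(`Exactness/NCMCGeneralSpaceRestartChainSampleSize.chain_variance_sum_le_of_doeblin`, bounded
class — hence the WORK FLOOR `W ≥ −B₀`, which makes the weight `e^{−W} ≤ e^{B₀}` a bounded
observable; physically the defect protocol's work is bounded below by construction).

* `CrooksPair.measureReal_meanWeight_dev_ge_le_restartChain` — `P(|(1/N)Σ_{i<N} e^{−W(εᵢ)}/m₁ − 1| ≥ η) ≤ (2/ε − 1)(1/ESS_F − 1)/(Nη²)`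
  along the chain;
* **`CrooksPair.kishFrac_le_prob_le_restartChain`** — the union bound above.

NOT CLAIMED: a Doeblin constant or a work floor for any concrete sweep / protocol; the size of the
overshoot.
-/

namespace Summit.Ventures.LatticeQCDFlow.Exactness.GeneralNCMC

open MeasureTheory ProbabilityTheory Set Filter Finset
open scoped ENNReal

variable {Ω E : Type*} [MeasurableSpace Ω] [MeasurableSpace E]

namespace CrooksPair

variable {ν₀ ν₁ : Measure Ω} {κF κR : Kernel Ω E} {s e : E → Ω} {W : E → ℝ}

/-- **Chebyshev for the mean weight ALONG THE RESTART CHAIN.**  Work floor `−B₀ ≤ W`; `ν₀`-invariant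
Markov `K` with `ε·(Z₀⁻¹ν₀)(B) ≤ K(z, B)`, `ε > 0`; `N ≥ 1`, `η > 0`; `m₁ = E_F e^{−W}`, `Z₂ = E_F e^{−2W}`:
`P( |(1/N)Σ_{i<N} e^{−W(εᵢ)}/m₁ − 1| ≥ η ) ≤ (2/ε − 1)·(Z₂/m₁² − 1)/(N η²)`. -/
theorem measureReal_meanWeight_dev_ge_le_restartChain (K : Kernel Ω Ω) [IsMarkovKernel K]
    [IsFiniteMeasure ν₀] [IsFiniteMeasure ν₁] [IsMarkovKernel κF] [IsMarkovKernel κR]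
    (h0 : ν₀ univ ≠ 0) (h1 : ν₁ univ ≠ 0) (hK : Kernel.Invariant K ν₀)
    (h : CrooksPair ν₀ ν₁ κF κR s e W) {B₀ : ℝ} (hWfloor : ∀ ε', -B₀ ≤ W ε')
    {ε : ℝ≥0∞} (hε0 : 0 < ε)
    (hmin : ∀ z (B : Set Ω), MeasurableSet B → ε * ((ν₀ univ)⁻¹ • ν₀) B ≤ K z B)
    {N : ℕ} (hN0 : N ≠ 0) {η : ℝ} (hη0 : 0 < η) :
    haveI := isProbabilityMeasure_fwdPathLaw ν₀ h0 κF
    (Kernel.trajMeasure (X := fun _ : ℕ => E) (fwdPathLaw ν₀ κF)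
        (fun n : ℕ => ((κF ∘ₖ K).comap s h.measurable_s).comap
          (fun hh : (j : ↥(Finset.Iic n)) → E => hh ⟨n, Finset.mem_Iic.2 le_rfl⟩)
          (measurable_pi_apply _))).real
      {x : ℕ → E | η ≤ |(1 / (N : ℝ)) * ∑ i ∈ range N, Real.exp (-W (x i))
          / (∫ ε', Real.exp (-W ε') ∂(fwdPathLaw ν₀ κF)) - 1|}
      ≤ (2 / ε.toReal - 1) * ((∫ ε', Real.exp (-(2 * W ε')) ∂(fwdPathLaw ν₀ κF))
          / (∫ ε', Real.exp (-W ε') ∂(fwdPathLaw ν₀ κF)) ^ 2 - 1) / (N * η ^ 2) := by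
  haveI := isProbabilityMeasure_fwdPathLaw ν₀ h0 κF
  set PF := fwdPathLaw ν₀ κF with hPF
  set R := (κF ∘ₖ K).comap s h.measurable_s with hR
  set P := Kernel.trajMeasure (X := fun _ : ℕ => E) PF
      (fun n : ℕ => R.comap (fun hh : (j : ↥(Finset.Iic n)) → E => hh ⟨n, Finset.mem_Iic.2 le_rfl⟩)
        (measurable_pi_apply _)) with hP
  set m₁ : ℝ := ∫ ε', Real.exp (-W ε') ∂PF with hm₁
  set Z₂ : ℝ := ∫ ε', Real.exp (-(2 * W ε')) ∂PF with hZ₂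
  have hW := h.measurable_W
  have hm₁pos : 0 < m₁ := by rw [hm₁, hPF, h.integral_exp_neg_work]; exact toReal_ratio_pos h0 h1
  have hNpos : (0 : ℝ) < N := by exact_mod_cast Nat.pos_of_ne_zero hN0
  have hπ : Kernel.Invariant R PF := h.invariant_restartKernel K hK
  have hminR : ∀ x {B : Set E}, MeasurableSet B → ε * PF B ≤ R x B := by
    intro x B hBm
    rw [hPF, fwdPathLaw_eq_bind_smul]
    exact minorized_comp_comap K κF h.measurable_s hmin x B hBm
  have hε1 : ε ≤ 1 := Scoring.eps_le_one_of_doeblin hminR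
  have hεr0 : 0 < ε.toReal :=
    ENNReal.toReal_pos hε0.ne' (ne_top_of_le_ne_top ENNReal.one_ne_top hε1)
  have hεr : ε.toReal ≤ 1 := by
    have := ENNReal.toReal_mono ENNReal.one_ne_top hε1
    simpa using this
  have hC0 : 0 ≤ 2 / ε.toReal - 1 := by
    rw [sub_nonneg, le_div_iff₀ hεr0]; linarith
  -- the bounded observable `g = e^{−W}/m₁`: mean 1, `Var g = Z₂/m₁² − 1`
  set g : E → ℝ := fun ε' => Real.exp (-W ε') / m₁ with hg
  have hgm : Measurable g := (Real.measurable_exp.comp hW.neg).div_const _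
  have hgb : ∀ ε', |g ε'| ≤ Real.exp B₀ / m₁ := by
    intro ε'
    rw [hg]; simp only
    rw [abs_of_nonneg (div_nonneg (Real.exp_pos _).le hm₁pos.le)]
    exact div_le_div_of_nonneg_right (Real.exp_le_exp.2 (by linarith [hWfloor ε'])) hm₁pos.le
  have hg2 : MemLp g 2 PF :=
    MemLp.of_bound hgm.aestronglyMeasurable (Real.exp B₀ / m₁)
      (Eventually.of_forall fun ε' => by rw [Real.norm_eq_abs]; exact hgb ε')
  have hg1 : ∫ ε', g ε' ∂PF = 1 := by
    simp only [hg]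
    rw [integral_div, ← hm₁, div_self hm₁pos.ne']
  have hsq : ∀ ε', Real.exp (-W ε') ^ 2 = Real.exp (-(2 * W ε')) := fun ε' => by
    rw [sq, ← Real.exp_add]; congr 1; ring
  have hgsq : ∫ ε', g ε' ^ 2 ∂PF = Z₂ / m₁ ^ 2 := by
    simp only [hg]
    have : ∀ ε', (Real.exp (-W ε') / m₁) ^ 2 = (1 / m₁ ^ 2) * Real.exp (-(2 * W ε')) := fun ε' => by
      rw [div_pow, hsq ε']; ring
    simp_rw [this]
    rw [integral_const_mul, ← hZ₂]; ring
  have hvarg : Var[g; PF] = Z₂ / m₁ ^ 2 - 1 := by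
    rw [variance_eq_sub hg2]
    have e1 : ∫ ε', ((fun ε' => g ε') ^ 2) ε' ∂PF = Z₂ / m₁ ^ 2 := by rw [← hgsq]; rfl
    have e2 : (∫ ε', (fun ε' => g ε') ε' ∂PF) = 1 := hg1
    rw [e1, e2]; ring
  -- the first `N` records as a law `Q` on `Fin N → E`
  have hr : Measurable (fun (x : ℕ → E) (j : Fin N) => x j) :=
    measurable_pi_lambda _ fun j => measurable_pi_apply _
  set Q := P.map (fun (x : ℕ → E) (j : Fin N) => x j) with hQ
  haveI : IsProbabilityMeasure Q := Measure.isProbabilityMeasure_map hr.aemeasurable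
  have hmarg : ∀ i : Fin N, Q.map (fun y => y i) = PF := fun i => by
    rw [hQ, hP]; exact chain_firstCoords_map_eval R hπ N i
  -- the sum `S = Σᵢ g(yᵢ)` under `Q`: mean `N`, variance `≤ (2/ε − 1)·N·Var g`
  set S : (Fin N → E) → ℝ := fun y => ∑ i, g (y i) with hS
  have hSm : Measurable S := Finset.measurable_sum _ fun i _ => hgm.comp (measurable_pi_apply i)
  have hSvar : Var[S; Q] ≤ (2 / ε.toReal - 1) * N * (Z₂ / m₁ ^ 2 - 1) := by
    rw [← hvarg, hQ, hP]
    exact chain_variance_sum_le_of_doeblin R hπ hminR hε0 hgm hgb N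
  have hY2 : ∀ i : Fin N, MemLp (fun y : Fin N → E => g (y i)) 2 Q := fun i =>
    hg2.comp_measurePreserving ⟨measurable_pi_apply i, hmarg i⟩
  have hS2 : MemLp S 2 Q := memLp_finsetSum _ (fun i _ => hY2 i)
  have hYint : ∀ i : Fin N, ∫ y, g (y i) ∂Q = 1 := by
    intro i
    rw [← hg1, ← hmarg i, integral_map (measurable_pi_apply i).aemeasurable hgm.aestronglyMeasurable]
  have hSint : ∫ y, S y ∂Q = N := by
    simp only [hS]
    rw [integral_finsetSum _ (fun i _ => (hY2 i).integrable one_le_two)]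
    simp only [hYint, Finset.sum_const, Finset.card_univ, Fintype.card_fin, nsmul_eq_mul, mul_one]
  -- the sample mean on `Fin N → E`, Chebyshev under `Q`
  have hXdef : (fun y : Fin N → E => (1 / (N : ℝ)) * ∑ i, Real.exp (-W (y i)) / m₁)
      = fun y => (1 / (N : ℝ)) * S y := by
    funext y; rfl
  have hX2 : MemLp (fun y : Fin N → E => (1 / (N : ℝ)) * ∑ i, Real.exp (-W (y i)) / m₁) 2 Q := by
    rw [hXdef]; exact hS2.const_mul _
  have hXint : ∫ y, (1 / (N : ℝ)) * ∑ i, Real.exp (-W (y i)) / m₁ ∂Q = 1 := by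
    have : ∫ y, (1 / (N : ℝ)) * ∑ i, Real.exp (-W (y i)) / m₁ ∂Q = ∫ y, (1 / (N : ℝ)) * S y ∂Q :=
      congrArg (fun F : (Fin N → E) → ℝ => ∫ y, F y ∂Q) hXdef
    rw [this, integral_const_mul, hSint]; field_simp
  have hXvar : Var[fun y : Fin N → E => (1 / (N : ℝ)) * ∑ i, Real.exp (-W (y i)) / m₁; Q]
      ≤ (2 / ε.toReal - 1) * (Z₂ / m₁ ^ 2 - 1) / N := by
    rw [hXdef, variance_const_mul]
    calc (1 / (N : ℝ)) ^ 2 * Var[S; Q] ≤ (1 / (N : ℝ)) ^ 2 * ((2 / ε.toReal - 1) * N * (Z₂ / m₁ ^ 2 - 1)) :=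
          mul_le_mul_of_nonneg_left hSvar (sq_nonneg _)
      _ = (2 / ε.toReal - 1) * (Z₂ / m₁ ^ 2 - 1) / N := by field_simp
  have hcheb := meas_ge_le_variance_div_sq hX2 hη0
  rw [hXint] at hcheb
  have hV0 : 0 ≤ Z₂ / m₁ ^ 2 - 1 := by rw [← hvarg]; exact variance_nonneg _ _
  have hnn : 0 ≤ (2 / ε.toReal - 1) * (Z₂ / m₁ ^ 2 - 1) / N / η ^ 2 := by positivity
  have hQB : Q.real {y : Fin N → E | η ≤ |(1 / (N : ℝ)) * ∑ i, Real.exp (-W (y i)) / m₁ - 1|}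
      ≤ (2 / ε.toReal - 1) * (Z₂ / m₁ ^ 2 - 1) / (N * η ^ 2) := by
    calc Q.real {y : Fin N → E | η ≤ |(1 / (N : ℝ)) * ∑ i, Real.exp (-W (y i)) / m₁ - 1|}
        ≤ (ENNReal.ofReal (Var[fun y : Fin N → E => (1 / (N : ℝ)) * ∑ i, Real.exp (-W (y i)) / m₁; Q]
            / η ^ 2)).toReal := ENNReal.toReal_mono ENNReal.ofReal_ne_top hcheb
      _ = Var[fun y : Fin N → E => (1 / (N : ℝ)) * ∑ i, Real.exp (-W (y i)) / m₁; Q] / η ^ 2 :=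
          ENNReal.toReal_ofReal (div_nonneg (variance_nonneg _ _) (sq_nonneg _))
      _ ≤ (2 / ε.toReal - 1) * (Z₂ / m₁ ^ 2 - 1) / N / η ^ 2 :=
          div_le_div_of_nonneg_right hXvar (sq_nonneg _)
      _ = (2 / ε.toReal - 1) * (Z₂ / m₁ ^ 2 - 1) / (N * η ^ 2) := by rw [div_div]
  -- pull back to the trajectory measure
  have hFm : Measurable (fun y : Fin N → E => (1 / (N : ℝ)) * ∑ i, Real.exp (-W (y i)) / m₁) := by
    rw [hXdef]; exact measurable_const.mul hSm
  have hBm : MeasurableSet {y : Fin N → E | η ≤ |(1 / (N : ℝ)) * ∑ i, Real.exp (-W (y i)) / m₁ - 1|} :=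
    measurableSet_le measurable_const ((hFm.sub measurable_const).abs)
  rw [hQ, map_measureReal_apply hr hBm] at hQB
  have hpre : (fun (x : ℕ → E) (j : Fin N) => x j) ⁻¹'
        {y : Fin N → E | η ≤ |(1 / (N : ℝ)) * ∑ i, Real.exp (-W (y i)) / m₁ - 1|}
      = {x : ℕ → E | η ≤ |(1 / (N : ℝ)) * ∑ i ∈ range N, Real.exp (-W (x i)) / m₁ - 1|} := by
    ext x
    simp only [Set.mem_preimage, Set.mem_setOf_eq]
    rw [Fin.sum_univ_eq_sum_range (fun i => Real.exp (-W (x i)) / m₁) N]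
  rw [hpre] at hQB
  exact hQB

/-- **THE PRINTED KISH FRACTION IS OVER-OPTIMISTIC WITH TOO FEW CONSECUTIVE EVOLUTIONS.**  Work floor
`−B₀ ≤ W` (so `e^{−2W} ∈ L¹`); level sampler `K` `ν₀`-invariant with `ε·(Z₀⁻¹ν₀)(B) ≤ K(z, B)`,
`ε > 0`; `t ≥ 0`… (only `N ≤ e^{L₂ − t}` is used), `N ≥ 1`, `δ ∈ (0,1)`, `η ∈ (0, 1]`.  Along the
equilibrium restart chain the event `ESŜ/N ≤ ((1 − η)²/(1 − δ))·ESS_F` has probability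
`≤ e^{−t/2} + P₂{ρ₂ ≤ e^{L₂ − t/2}}/(1 − δ) + (2/ε − 1)·(1/ESS_F − 1)/(N η²)`. -/
theorem kishFrac_le_prob_le_restartChain (K : Kernel Ω Ω) [IsMarkovKernel K]
    [IsFiniteMeasure ν₀] [IsFiniteMeasure ν₁] [IsMarkovKernel κF] [IsMarkovKernel κR]
    (h0 : ν₀ univ ≠ 0) (h1 : ν₁ univ ≠ 0) (hK : Kernel.Invariant K ν₀)
    (h : CrooksPair ν₀ ν₁ κF κR s e W) {B₀ : ℝ} (hWfloor : ∀ ε', -B₀ ≤ W ε')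
    {ε : ℝ≥0∞} (hε0 : 0 < ε)
    (hmin : ∀ z (B : Set Ω), MeasurableSet B → ε * ((ν₀ univ)⁻¹ • ν₀) B ≤ K z B)
    {t : ℝ} {N : ℕ} (hN0 : N ≠ 0)
    (hN : (N : ℝ) ≤ Real.exp ((∫ ε', (-(2 * W ε')
        - Real.log (∫ ε'', Real.exp (-(2 * W ε'')) ∂(fwdPathLaw ν₀ κF)))
          ∂((fwdPathLaw ν₀ κF).tilted fun ε' => -(2 * W ε'))) - t))
    {δ : ℝ} (hδ1 : δ < 1) {η : ℝ} (hη0 : 0 < η) (hη1 : η ≤ 1) :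
    haveI := isProbabilityMeasure_fwdPathLaw ν₀ h0 κF
    (Kernel.trajMeasure (X := fun _ : ℕ => E) (fwdPathLaw ν₀ κF)
        (fun n : ℕ => ((κF ∘ₖ K).comap s h.measurable_s).comap
          (fun hh : (j : ↥(Finset.Iic n)) → E => hh ⟨n, Finset.mem_Iic.2 le_rfl⟩)
          (measurable_pi_apply _))).real
      {x : ℕ → E | ((1 / (N : ℝ)) * ∑ i ∈ range N, Real.exp (-W (x i))) ^ 2
            / ((1 / (N : ℝ)) * ∑ i ∈ range N, Real.exp (-(2 * W (x i))))
          ≤ (1 - η) ^ 2 / (1 - δ) *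
            ((∫ ε', Real.exp (-W ε') ∂(fwdPathLaw ν₀ κF)) ^ 2
              / ∫ ε', Real.exp (-(2 * W ε')) ∂(fwdPathLaw ν₀ κF))}
      ≤ Real.exp (-t / 2)
        + ((fwdPathLaw ν₀ κF).tilted fun ε' => -(2 * W ε')).real
            {ε' | Real.exp (-(2 * W ε')) / ∫ ε'', Real.exp (-(2 * W ε'')) ∂(fwdPathLaw ν₀ κF)
              ≤ Real.exp ((∫ ε', (-(2 * W ε')
                  - Real.log (∫ ε'', Real.exp (-(2 * W ε'')) ∂(fwdPathLaw ν₀ κF)))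
                    ∂((fwdPathLaw ν₀ κF).tilted fun ε' => -(2 * W ε'))) - t / 2)} / (1 - δ)
        + (2 / ε.toReal - 1) * ((∫ ε', Real.exp (-(2 * W ε')) ∂(fwdPathLaw ν₀ κF))
            / (∫ ε', Real.exp (-W ε') ∂(fwdPathLaw ν₀ κF)) ^ 2 - 1) / (N * η ^ 2) := by
  haveI := isProbabilityMeasure_fwdPathLaw ν₀ h0 κF
  set PF := fwdPathLaw ν₀ κF with hPF
  set P := Kernel.trajMeasure (X := fun _ : ℕ => E) PF
      (fun n : ℕ => ((κF ∘ₖ K).comap s h.measurable_s).comap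
        (fun hh : (j : ↥(Finset.Iic n)) → E => hh ⟨n, Finset.mem_Iic.2 le_rfl⟩)
        (measurable_pi_apply _)) with hP
  set m₁ : ℝ := ∫ ε', Real.exp (-W ε') ∂PF with hm₁
  set Z₂ : ℝ := ∫ ε', Real.exp (-(2 * W ε')) ∂PF with hZ₂
  have hW := h.measurable_W
  have hsq : ∀ ε', Real.exp (-W ε') ^ 2 = Real.exp (-(2 * W ε')) := fun ε' => by
    rw [sq, ← Real.exp_add]; congr 1; ring
  have hwb : MemLp (fun ε' => Real.exp (-W ε')) 2 PF :=
    MemLp.of_bound (Real.measurable_exp.comp hW.neg).aestronglyMeasurable (Real.exp B₀)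
      (Eventually.of_forall fun ε' => by
        rw [Real.norm_eq_abs, abs_of_nonneg (Real.exp_pos _).le]
        exact Real.exp_le_exp.2 (by linarith [hWfloor ε']))
  have hint : Integrable (fun ε' => Real.exp (-(2 * W ε'))) PF :=
    hwb.integrable_sq.congr (Eventually.of_forall fun ε' => hsq ε')
  have hm₁pos : 0 < m₁ := by rw [hm₁, hPF, h.integral_exp_neg_work]; exact toReal_ratio_pos h0 h1
  have hZ₂pos : 0 < Z₂ := by rw [hZ₂]; exact integral_exp_pos hint
  have hNpos : (0 : ℝ) < N := by exact_mod_cast Nat.pos_of_ne_zero hN0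
  set A : Set (ℕ → E) := {x | 1 - δ ≤ (1 / (N : ℝ)) * ∑ i ∈ range N, Real.exp (-(2 * W (x i))) / Z₂}
    with hA
  set B : Set (ℕ → E) := {x | η ≤ |(1 / (N : ℝ)) * ∑ i ∈ range N, Real.exp (-W (x i)) / m₁ - 1|}
    with hB
  have hPA := h.kish_sampleSize_necessary_restartChain K h0 hK hint (t := t) hN hδ1
  have hPB := h.measureReal_meanWeight_dev_ge_le_restartChain K h0 h1 hK hWfloor hε0 hmin hN0 hη0
  have hsub : {x : ℕ → E | ((1 / (N : ℝ)) * ∑ i ∈ range N, Real.exp (-W (x i))) ^ 2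
        / ((1 / (N : ℝ)) * ∑ i ∈ range N, Real.exp (-(2 * W (x i))))
        ≤ (1 - η) ^ 2 / (1 - δ) * (m₁ ^ 2 / Z₂)} ⊆ A ∪ B := by
    intro x hx
    simp only [mem_setOf_eq] at hx
    by_contra hnot
    simp only [hA, hB, mem_union, mem_setOf_eq, not_or, not_le] at hnot
    obtain ⟨hxA, hxB⟩ := hnot
    set S₁ : ℝ := (1 / (N : ℝ)) * ∑ i ∈ range N, Real.exp (-W (x i)) with hS₁
    set S₂ : ℝ := (1 / (N : ℝ)) * ∑ i ∈ range N, Real.exp (-(2 * W (x i))) with hS₂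
    have h2 : (1 / (N : ℝ)) * ∑ i ∈ range N, Real.exp (-(2 * W (x i))) / Z₂ = S₂ / Z₂ := by
      rw [hS₂, ← Finset.sum_div, mul_div_assoc]
    rw [h2, div_lt_iff₀ hZ₂pos] at hxA
    have h3 : (1 / (N : ℝ)) * ∑ i ∈ range N, Real.exp (-W (x i)) / m₁ = S₁ / m₁ := by
      rw [hS₁, ← Finset.sum_div, mul_div_assoc]
    rw [h3] at hxB
    have h4 : 1 - η < S₁ / m₁ := by
      have := (abs_lt.1 hxB).1
      linarith
    rw [lt_div_iff₀ hm₁pos] at h4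
    have h5 : 0 < S₂ := by
      rw [hS₂]
      refine mul_pos (by positivity) (Finset.sum_pos (fun i _ => Real.exp_pos _) ?_)
      exact ⟨0, Finset.mem_range.2 (Nat.pos_of_ne_zero hN0)⟩
    exact absurd hx (not_le.2 (kishFrac_gt_of_moments hm₁pos hZ₂pos hη1 hδ1 h4 h5 hxA))
  calc P.real {x : ℕ → E | ((1 / (N : ℝ)) * ∑ i ∈ range N, Real.exp (-W (x i))) ^ 2
          / ((1 / (N : ℝ)) * ∑ i ∈ range N, Real.exp (-(2 * W (x i))))
          ≤ (1 - η) ^ 2 / (1 - δ) * (m₁ ^ 2 / Z₂)}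
      ≤ P.real (A ∪ B) := measureReal_mono hsub
    _ ≤ P.real A + P.real B := measureReal_union_le A B
    _ ≤ _ := add_le_add hPA hPB

end CrooksPair

end Summit.Ventures.LatticeQCDFlow.Exactness.GeneralNCMC
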